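import Literature.Computability.MetaComplexity.RandomScopes
import Literature.Computability.MetaComplexity.ScopeExpansionEstimates
import HarnessLib

/-!
# Proof of the KMOW random-graph theorem for `k`-SAT (`kmow_random_kCNF_plausible`)

Trunk Literature/Computability/MetaComplexity. DISCHARGE of the named fact
`kmow_random_kCNF_plausible` (`ScopeExpansion.lean`): Kothari–Mori–O'Donnell–Witmer 2017,
Thm. 4.12 (first claim), specialised to `k`-SAT, with the universal exponent `C₀ = 2000`.

The proof is the first-moment argument of their Appendix A, run directly on cover expansion:
if some family `F` of `c ≤ 2·SMALL` clause positions of `φ ∼ F_k(n, Δn)` covers fewer than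
`(k+ζ)c/2` variables, then all `c` scopes lie in a set `V ⊆ {0,…,n-1}` of exactly
`t_c = ⌈(k+ζ)c/2⌉ - 1` variables; for fixed `(F, V)` this has probability
`(|{x ∈ kClauses k n : scope x ⊆ V}| / |kClauses k n|)^c ≤ (C(t_c,k)/C(n,k))^c` (the clauses are
i.i.d. uniform: product counting in `Fin m → kClauses k n`, `RandomScopes.lean`), and summing over
the `C(Δn, c) · C(n, t_c)` pairs and over `c ≥ 1` gives at most `Σ_c (β/4)^c ≤ β`
(`ScopeExpansionEstimates.lean`).

* `card_filter_forall_clauseScope_subset_le` — the probability of the event "all scopes in `F` lie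
  in `V`", as a count;
* `card_le_of_forall_not_isCoverExpander` — the union bound as a counting statement;
* `kmow_random_kCNF_plausible_holds` — the discharge.

## References

* P. K. Kothari, R. Mori, R. O'Donnell, D. Witmer, *Sum of squares lower bounds for refuting any
  CSP*, STOC 2017, arXiv:1701.04521: Thm. 4.12 (= Thm. 6 of §4; restated and proved in
  Appendix A), Notation 2.5, §2.2 (Plausibility Assumption), Lemma 4.11.
-/

noncomputable section

open Finset Literature.Computability.Complexity

namespace Literature.Computability.MetaComplexity

/-! ### The union bound -/

/-- **One event of the union bound.** The tuples of `m` clauses whose scopes at the positions in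
`F` all lie inside `V` number at most `(C(|V|,k) 2^k)^{|F|} · |kClauses k n|^{m-|F|}` (independence
= product counting, and the scope marginal). [Kothari–Mori–O'Donnell–Witmer 2017, Appendix A
((cv-bound2))] [folklore] -/
theorem card_filter_forall_clauseScope_subset_le {k n m : ℕ} (F : Finset (Fin m)) (V : Finset ℕ) :
    ((univ : Finset (Fin m → ↥(kClauses k n))).filter
        fun c => ∀ i ∈ F, clauseScope (c i : Clause ℕ) ⊆ V).card ≤
      (V.card.choose k * 2 ^ k) ^ F.card * (kClauses k n).card ^ (m - F.card) := by
  classical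
  set A : Finset ↥(kClauses k n) := univ.filter fun x => clauseScope (x : Clause ℕ) ⊆ V with hA
  have h1 : ((univ : Finset (Fin m → ↥(kClauses k n))).filter
      fun c => ∀ i ∈ F, clauseScope (c i : Clause ℕ) ⊆ V) =
      univ.filter fun c => ∀ i ∈ F, c i ∈ A := by
    ext c
    simp [hA]
  have hAcard : A.card ≤ V.card.choose k * 2 ^ k :=
    calc A.card = (A.map (Function.Embedding.subtype _)).card := (card_map _).symm
      _ ≤ ((kClauses k n).filter fun x => clauseScope x ⊆ V).card := by
          refine card_le_card fun x hx => ?_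
          rw [mem_map] at hx
          obtain ⟨y, hy, rfl⟩ := hx
          rw [hA, mem_filter] at hy
          exact mem_filter.2 ⟨y.2, hy.2⟩
      _ ≤ _ := card_filter_clauseScope_subset_le k n V
  rw [h1, card_filter_forall_mem F A, Fintype.card_coe]
  exact Nat.mul_le_mul_right _ (Nat.pow_le_pow_left hAcard _)

/-- **Union bound (counting form).** Let `a ≥ 0` with `a N ≤ n`. Every tuple of `m` clauses from
`kClauses k n` whose scope family fails cover expansion `(N, a)` has a family `F` of
`c ∈ [1, N]` positions and a set `V ⊆ {0,…,n-1}` of exactly `⌈a c⌉ - 1` variables containing all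
scopes `F` points to; hence the number of such tuples is at most
`Σ_{c=1}^{N} C(m,c) · C(n, ⌈ac⌉-1) · (C(⌈ac⌉-1, k) 2^k)^c · |kClauses k n|^{m-c}`.
[Kothari–Mori–O'Donnell–Witmer 2017, Appendix A ((cv-bound1), (cv-bound2))] [folklore] -/
theorem card_le_of_forall_not_isCoverExpander {k n m N : ℕ} {a : ℝ} (ha : 0 ≤ a)
    (haN : a * N ≤ n) (bad : Finset (Fin m → ↥(kClauses k n)))
    (hbad : ∀ c ∈ bad, ¬ IsCoverExpander (fun i => clauseScope (c i : Clause ℕ)) N a) :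
    bad.card ≤ ∑ c ∈ Finset.Ico 1 (N + 1), m.choose c * (n.choose (⌈a * c⌉₊ - 1) *
      (((⌈a * c⌉₊ - 1).choose k * 2 ^ k) ^ c * (kClauses k n).card ^ (m - c))) := by
  classical
  -- covering
  have hcover : bad ⊆ (Finset.Ico 1 (N + 1)).biUnion fun c =>
      ((univ : Finset (Fin m)).powersetCard c).biUnion fun F =>
        ((Finset.range n).powersetCard (⌈a * c⌉₊ - 1)).biUnion fun V =>
          (univ : Finset (Fin m → ↥(kClauses k n))).filter
            fun c => ∀ i ∈ F, clauseScope (c i : Clause ℕ) ⊆ V := by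
    intro c hc
    have hc' := hbad c hc
    unfold IsCoverExpander at hc'
    push Not at hc'
    obtain ⟨F, hFN, hlt⟩ := hc'
    have hF0 : 1 ≤ F.card := by
      rcases Nat.eq_zero_or_pos F.card with h | h
      · exfalso
        rw [Finset.card_eq_zero.1 h] at hlt
        simp [cover] at hlt
      · exact h
    have hFN' : F.card ≤ N := by exact_mod_cast hFN
    have hsub : cover (fun i => clauseScope (c i : Clause ℕ)) F ⊆ Finset.range n := by
      intro v hv
      rw [mem_cover] at hv
      obtain ⟨i, -, hv⟩ := hv
      exact clauseScope_subset_range (c i).2 hv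
    have hct : (cover (fun i => clauseScope (c i : Clause ℕ)) F).card ≤
        ⌈a * (F.card : ℝ)⌉₊ - 1 := by
      have h1 : ((cover (fun i => clauseScope (c i : Clause ℕ)) F).card : ℝ) <
          ⌈a * (F.card : ℝ)⌉₊ := hlt.trans_le (Nat.le_ceil _)
      have h2 : (cover (fun i => clauseScope (c i : Clause ℕ)) F).card < ⌈a * (F.card : ℝ)⌉₊ := by
        exact_mod_cast h1
      omega
    have htn : ⌈a * (F.card : ℝ)⌉₊ - 1 ≤ n := by
      have h1 : a * F.card ≤ n := (mul_le_mul_of_nonneg_left hFN ha).trans haN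
      have h2 : ⌈a * (F.card : ℝ)⌉₊ ≤ n := Nat.ceil_le.2 h1
      omega
    obtain ⟨V, hcV, hVr, hVcard⟩ :=
      Finset.exists_subsuperset_card_eq hsub hct (by rw [card_range]; exact htn)
    refine mem_biUnion.2 ⟨F.card, mem_Ico.2 ⟨hF0, Nat.lt_succ_of_le hFN'⟩, mem_biUnion.2
      ⟨F, mem_powersetCard.2 ⟨subset_univ _, rfl⟩, mem_biUnion.2
        ⟨V, mem_powersetCard.2 ⟨hVr, hVcard⟩, ?_⟩⟩⟩
    exact mem_filter.2 ⟨mem_univ _, fun i hi => (subset_cover hi).trans hcV⟩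
  -- counting
  calc bad.card ≤ _ := card_le_card hcover
    _ ≤ ∑ c ∈ Finset.Ico 1 (N + 1), (((univ : Finset (Fin m)).powersetCard c).biUnion fun F =>
          ((Finset.range n).powersetCard (⌈a * c⌉₊ - 1)).biUnion fun V =>
            (univ : Finset (Fin m → ↥(kClauses k n))).filter
              fun c => ∀ i ∈ F, clauseScope (c i : Clause ℕ) ⊆ V).card := card_biUnion_le
    _ ≤ ∑ c ∈ Finset.Ico 1 (N + 1), ∑ F ∈ (univ : Finset (Fin m)).powersetCard c,
          (((Finset.range n).powersetCard (⌈a * c⌉₊ - 1)).biUnion fun V =>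
            (univ : Finset (Fin m → ↥(kClauses k n))).filter
              fun c => ∀ i ∈ F, clauseScope (c i : Clause ℕ) ⊆ V).card :=
        sum_le_sum fun c _ => card_biUnion_le
    _ ≤ ∑ c ∈ Finset.Ico 1 (N + 1), ∑ F ∈ (univ : Finset (Fin m)).powersetCard c,
          ∑ V ∈ (Finset.range n).powersetCard (⌈a * c⌉₊ - 1),
            ((univ : Finset (Fin m → ↥(kClauses k n))).filter
              fun c => ∀ i ∈ F, clauseScope (c i : Clause ℕ) ⊆ V).card :=
        sum_le_sum fun c _ => sum_le_sum fun F _ => card_biUnion_le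
    _ ≤ ∑ c ∈ Finset.Ico 1 (N + 1), ∑ F ∈ (univ : Finset (Fin m)).powersetCard c,
          ∑ V ∈ (Finset.range n).powersetCard (⌈a * c⌉₊ - 1),
            ((⌈a * c⌉₊ - 1).choose k * 2 ^ k) ^ c * (kClauses k n).card ^ (m - c) := by
        refine sum_le_sum fun c _ => sum_le_sum fun F hF => sum_le_sum fun V hV => ?_
        rw [mem_powersetCard] at hF hV
        have h := card_filter_forall_clauseScope_subset_le (k := k) (n := n) F V
        rw [hF.2, hV.2] at h
        exact h
    _ = _ := by
        refine sum_congr rfl fun c _ => ?_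
        rw [sum_const, sum_const, card_powersetCard, card_univ, Fintype.card_fin, card_powersetCard,
          card_range, smul_eq_mul, smul_eq_mul]

/-! ### The discharge -/

/-- **Kothari–Mori–O'Donnell–Witmer 2017, Thm. 4.12 (first claim) for `k`-SAT, proved**: the
named fact `kmow_random_kCNF_plausible` holds, with universal exponent `C₀ = 2000`. For
`φ ∼ F_k(n, Δn)` and `SMALL = nₛ ≤ γ n / Δ^{2/(k-2-ζ)}`, `γ = kmowGamma 2000 k β`, the scope
family of `φ` is a `(2nₛ, (k+ζ)/2)`-cover expander (= the Plausibility Assumption for `τ = k`)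
except with probability at most `β`. Proof: Appendix A's first-moment count
(`card_le_of_forall_not_isCoverExpander`, `kmow_term_le`, `sum_Ico_pow_div_four_le`) and the
probability glue `randomKCNF_toOuterMeasure_ge`; the degenerate cases `Δ = 0` / `n < k` give the
empty formula, which is trivially expanding. [cite: arXiv170104521, Thm. 4.12] -/
theorem kmow_random_kCNF_plausible_holds : kmow_random_kCNF_plausible := by
  refine ⟨2000, by norm_num, ?_⟩
  intro k Δ hk ζ β hζ hζ' hβ hβ' n nₛ hnₛ h2n hkζ hsm
  classical
  -- degenerate cases: the formula is empty
  by_cases htriv : Δ = 0 ∨ ¬ (kClauses k n).Nonempty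
  · have hpure : randomKCNF k n (Δ * n) = PMF.pure [] := by
      rcases htriv with h | h
      · rw [h, zero_mul, randomKCNF_zero_clauses]
      · unfold randomKCNF
        rw [dif_neg h]
    rw [hpure, PMF.toOuterMeasure_pure_apply, if_pos]
    · exact tsub_le_self
    · intro F _
      have hF : F = ∅ := by
        ext i
        exact i.elim0
      subst hF
      simp
  push Not at htriv
  obtain ⟨hΔ0, hne⟩ := htriv
  have hΔ : 1 ≤ Δ := Nat.one_le_iff_ne_zero.2 hΔ0
  have hk3 : (3 : ℝ) ≤ k := by exact_mod_cast hk
  -- parameters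
  set a : ℝ := ((k : ℝ) + ζ) / 2 with ha
  set N : ℕ := 2 * nₛ with hN
  set m : ℕ := Δ * n with hm
  have hapos : 0 < a := by rw [ha]; positivity
  have hNcast : ((N : ℕ) : ℝ) = 2 * (nₛ : ℝ) := by rw [hN]; push_cast; ring
  have hsmall := kmow_small_le hk hζ' hβ hβ' hΔ hsm
  have haN : a * N ≤ n := by
    rw [hNcast, ha]
    nlinarith
  -- the bad tuples
  set bad : Finset (Fin m → ↥(kClauses k n)) :=
    univ.filter fun c => ¬ IsCoverExpander (fun i => clauseScope (c i : Clause ℕ)) N a with hbad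
  refine randomKCNF_toOuterMeasure_ge hne hβ.le bad (fun c hc => ?_) ?_
  · -- good tuples give expanding formulas
    have hc' : IsCoverExpander (fun i => clauseScope (c i : Clause ℕ)) N a := by
      by_contra h
      exact hc (mem_filter.2 ⟨mem_univ _, h⟩)
    have h1 := hc'.cnfScopes_ofFn
    rw [hNcast] at h1
    exact h1
  · -- the count
    have hcount := card_le_of_forall_not_isCoverExpander (k := k) hapos.le haN bad
      (fun c hc => (mem_filter.1 hc).2)
    have hK : (kClauses k n).card = n.choose k * 2 ^ k := card_kClauses k n
    have hKpos : 0 < (kClauses k n).card := card_pos.2 hne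
    have hchoose : 0 < n.choose k := by
      refine Nat.pos_of_ne_zero fun h => ?_
      rw [hK, h, zero_mul] at hKpos
      exact lt_irrefl _ hKpos
    set K : ℝ := ((kClauses k n).card : ℝ) with hKdef
    have hKreal : K = (n.choose k : ℝ) * 2 ^ k := by
      rw [hKdef, hK]
      push_cast
      ring
    have hch' : (0 : ℝ) < n.choose k := by exact_mod_cast hchoose
    -- the per-size bound
    have hterm : ∀ c ∈ Finset.Ico 1 (N + 1),
        (m.choose c : ℝ) * ((n.choose (⌈a * c⌉₊ - 1) : ℝ) *
          ((((⌈a * c⌉₊ - 1).choose k : ℝ) * 2 ^ k) ^ c * K ^ (m - c))) ≤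
        K ^ m * (β / 4) ^ c := by
      intro c hc
      rw [Finset.mem_Ico] at hc
      obtain ⟨hc1, hcN⟩ := hc
      have hcN' : c ≤ N := Nat.lt_succ_iff.1 hcN
      have hcNr : (c : ℝ) ≤ N := by exact_mod_cast hcN'
      set t : ℕ := ⌈a * c⌉₊ - 1 with htdef
      have hac : 0 < a * c := by positivity
      have hceil : 1 ≤ ⌈a * (c : ℝ)⌉₊ := Nat.one_le_iff_ne_zero.2 (Nat.ceil_pos.2 hac).ne'
      have htcast : (t : ℝ) = ⌈a * (c : ℝ)⌉₊ - 1 := by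
        rw [htdef, Nat.cast_sub hceil, Nat.cast_one]
      have ht1 : (t : ℝ) < a * c := by
        rw [htcast]
        linarith [Nat.ceil_lt_add_one hac.le]
      have ht2 : a * c ≤ t + 1 := by
        rw [htcast]
        linarith [Nat.le_ceil (a * c)]
      have htn : t ≤ n := by
        have h1 : a * c ≤ n := (mul_le_mul_of_nonneg_left hcNr hapos.le).trans haN
        have h2 := Nat.ceil_le.2 h1
        omega
      have hcs : (c : ℝ) ≤ 2 * (kmowGamma 2000 k β * n / (Δ : ℝ) ^ (2 / ((k : ℝ) - 2 - ζ))) := by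
        rw [hNcast] at hcNr
        linarith
      have hT := kmow_term_le hk hζ hζ' hβ hβ' hΔ hc1 ht1 ht2 htn hcs
      by_cases hcm : c ≤ m
      · have hsplit : K ^ m = K ^ c * K ^ (m - c) := (pow_mul_pow_sub K hcm).symm
        have hfac : ((t.choose k : ℝ)) * 2 ^ k = K * ((t.choose k : ℝ) / n.choose k) := by
          rw [hKreal]
          field_simp
        calc (m.choose c : ℝ) * ((n.choose t : ℝ) *
              ((((t.choose k : ℝ)) * 2 ^ k) ^ c * K ^ (m - c)))
            = K ^ m * (((m.choose c : ℝ)) * n.choose t *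
                ((t.choose k : ℝ) / n.choose k) ^ c) := by
              rw [hfac, mul_pow, hsplit]
              ring
          _ ≤ K ^ m * (β / 4) ^ c := mul_le_mul_of_nonneg_left hT (by positivity)
      · have h0 : m.choose c = 0 := Nat.choose_eq_zero_of_lt (not_le.1 hcm)
        rw [h0, Nat.cast_zero, zero_mul]
        positivity
    -- summing up
    calc (bad.card : ℝ)
        ≤ ∑ c ∈ Finset.Ico 1 (N + 1), (m.choose c : ℝ) * ((n.choose (⌈a * c⌉₊ - 1) : ℝ) *
            ((((⌈a * c⌉₊ - 1).choose k : ℝ) * 2 ^ k) ^ c * K ^ (m - c))) := by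
          rw [hKdef]
          exact_mod_cast hcount
      _ ≤ ∑ c ∈ Finset.Ico 1 (N + 1), K ^ m * (β / 4) ^ c := sum_le_sum hterm
      _ = K ^ m * ∑ c ∈ Finset.Ico 1 (N + 1), (β / 4) ^ c := by rw [mul_sum]
      _ ≤ K ^ m * β := by
          gcongr
          exact sum_Ico_pow_div_four_le hβ.le (by linarith) N
      _ = β * (((kClauses k n).card ^ m : ℕ) : ℝ) := by
          rw [hKdef]
          push_cast
          ring

end Literature.Computability.MetaComplexity
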